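import Literature.NumberTheory.Sieve.SmoothABCPairs
import HarnessLib

/-!
# The polylog regime `y = ⌊(log x)^{100000}⌋` at all scales `z ∈ [√x, x]`

Topic `Literature/NumberTheory/Sieve`; a PROVED tool file (bookkeeping of limits only).  In the
Lagarias–Soundararajan / Harper polylog regime `y = (log x)^K` with the fixed exponent `K = 100000`, the
side conditions of Harper's restriction bound for friable exponential sums ([Harper2016, Thm 2 and §5]; in
the tree `ternary_holder_restriction`, `ternary_crude_count`) hold not only at the scale `x` but at
EVERY natural scale `z` with `√x ≤ z ≤ x` — the scales of the shrunken boxes met when counting friable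
solutions of `a + b = c` with a divisibility condition `q^v ∣ a`:

* `polylog_regime_basic` — for all large real `x`, with `L = log x`, `y = ⌊L^{100000}⌋`: `x > 1`, `L ≥ 2`,
  `2 ≤ y`, `L^{100000}/2 ≤ y ≤ L^{100000}`, `L⁴ ≤ y`, `L⁸ ≤ y`, `log y ≤ ½ L^{1/6} ≤ L^{1/5}`,
  `y^{200} ≤ √x ≤ x`;
* `polylog_regime_at_scales` — for every threshold `z₀` and all large real `x`, every natural `z` with
  `√x ≤ z ≤ x` has `z ≥ z₀`, `(log z)⁸ ≤ y`, `log y ≤ ½ (log z)^{1/6}`, `y^{200} ≤ z`,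
  `α(z, y) ≥ 1 − 10⁻⁴` (`le_saddlePoint_of_polylog`: `1 − α ≤ 1/K + o(1)`, [Harper2016, §5]) and
  `Ψ(z, y) ≥ z^{39999/40000}` (`card_smoothNumbersUpTo_polylog_ge` and monotonicity in the friability
  level, `Endgame.smoothNumbersUpTo_mono_right`).

The pattern is that of `Endgame.regime_facts` (`SmoothABCPairs.lean`), at variable scales.

## References

* A. J. Harper, *Minor arcs, mean values, and restriction theory for exponential sums over smooth
  numbers*, Compositio Math. 152 (2016) 1121–1158, §2.1 (2.1) and §5 [Harper2016].
-/

noncomputable section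

open Finset Filter Real

namespace Literature.NumberTheory.Sieve

namespace PolylogScales

/-- Transport of an eventual property of naturals to all natural scales `z ≥ √x`, `x → ∞` real.
[folklore] -/
theorem eventually_scales {p : ℕ → Prop} (h : ∀ᶠ z : ℕ in atTop, p z) :
    ∀ᶠ x : ℝ in atTop, ∀ z : ℕ, x ^ (1 / 2 : ℝ) ≤ z → p z := by
  obtain ⟨z₀, hz₀⟩ := eventually_atTop.1 h
  filter_upwards [(tendsto_rpow_atTop (show (0 : ℝ) < 1 / 2 by norm_num)).eventually_ge_atTop (z₀ : ℝ)]
    with x hx z hz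
  exact hz₀ z (by exact_mod_cast hx.trans hz)

/-- `log log x ≤ c (log x)^{1/6}` for every `c > 0` and all large `x`. [folklore] -/
theorem eventually_loglog_le {c : ℝ} (hc : 0 < c) :
    ∀ᶠ x : ℝ in atTop, Real.log (Real.log x) ≤ c * Real.log x ^ (1 / 6 : ℝ) := by
  have h := (isLittleO_log_rpow_atTop (show (0 : ℝ) < 1 / 6 by norm_num)).def hc
  filter_upwards [Real.tendsto_log_atTop.eventually h, Real.tendsto_log_atTop.eventually_ge_atTop 1]
    with x hx hL
  rwa [Real.norm_of_nonneg (Real.log_nonneg hL),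
    Real.norm_of_nonneg (Real.rpow_nonneg (by linarith) _)] at hx

/-- `(log x)^{2·10⁷} ≤ √x` for all large `x`. [folklore] -/
theorem eventually_log_pow_le_sqrt :
    ∀ᶠ x : ℝ in atTop, Real.log x ^ (200 * 100000) ≤ x ^ (1 / 2 : ℝ) := by
  have h := (isLittleO_log_rpow_rpow_atTop (((200 * 100000 : ℕ) : ℝ))
    (show (0 : ℝ) < 1 / 2 by norm_num)).def one_pos
  filter_upwards [h, eventually_ge_atTop (1 : ℝ)] with x hx hx1
  rw [Real.rpow_natCast, one_mul, Real.norm_of_nonneg (pow_nonneg (Real.log_nonneg hx1) _),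
    Real.norm_of_nonneg (Real.rpow_nonneg (by linarith) _)] at hx
  exact hx

end PolylogScales

open PolylogScales

/-- **The polylog regime, basic range facts.**  For all large real `x`, with `L = log x` and
`y = ⌊L^{100000}⌋`: `x > 1`, `L ≥ 2`, `2 ≤ y`, `L^{100000}/2 ≤ y ≤ L^{100000}`, `L⁴ ≤ y`, `L⁸ ≤ y`,
`log y ≤ ½ L^{1/6}`, `log y ≤ L^{1/5}`, `y^{200} ≤ √x` and `√x ≤ x`.
[cite: Harper2016, §5 (proof of Prop. 5)] -/
theorem polylog_regime_basic :
    ∀ᶠ x : ℝ in atTop, 1 < x ∧ 2 ≤ Real.log x ∧ 2 ≤ ⌊Real.log x ^ 100000⌋₊ ∧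
      Real.log x ^ 100000 / 2 ≤ (⌊Real.log x ^ 100000⌋₊ : ℝ) ∧
      (⌊Real.log x ^ 100000⌋₊ : ℝ) ≤ Real.log x ^ 100000 ∧
      Real.log x ^ 4 ≤ (⌊Real.log x ^ 100000⌋₊ : ℝ) ∧ Real.log x ^ 8 ≤ (⌊Real.log x ^ 100000⌋₊ : ℝ) ∧
      Real.log (⌊Real.log x ^ 100000⌋₊ : ℝ) ≤ 1 / 2 * Real.log x ^ (1 / 6 : ℝ) ∧
      Real.log (⌊Real.log x ^ 100000⌋₊ : ℝ) ≤ Real.log x ^ (1 / 5 : ℝ) ∧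
      ((⌊Real.log x ^ 100000⌋₊ : ℕ) : ℝ) ^ 200 ≤ x ^ (1 / 2 : ℝ) ∧ x ^ (1 / 2 : ℝ) ≤ x := by
  set c₁ : ℝ := 1 / (2 * 100000) * (1 / 2 : ℝ) ^ (1 / 6 : ℝ) with hc₁
  have hc₁0 : 0 < c₁ := by positivity
  filter_upwards [eventually_ge_atTop (Real.exp 2), eventually_loglog_le hc₁0, eventually_log_pow_le_sqrt]
    with x h1 h2 h3
  set L : ℝ := Real.log x with hL
  set y : ℕ := ⌊L ^ 100000⌋₊ with hy
  have hx0 : 0 < x := lt_of_lt_of_le (Real.exp_pos 2) h1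
  have hL2 : 2 ≤ L := by rw [hL, Real.le_log_iff_exp_le hx0]; exact h1
  have hL1 : 1 ≤ L := by linarith
  have hL0 : 0 ≤ L := by linarith
  have hx1 : 1 < x := by
    have : (1 : ℝ) < Real.exp 2 := Real.one_lt_exp_iff.2 (by norm_num)
    linarith
  have hyK : (y : ℝ) ≤ L ^ 100000 := Nat.floor_le (pow_nonneg hL0 _)
  have hLK2 : 2 ≤ L ^ 100000 := hL2.trans (le_self_pow₀ hL1 (by norm_num))
  have hyK' : L ^ 100000 / 2 ≤ y := by
    have h := Nat.lt_floor_add_one (L ^ 100000)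
    rw [hy]
    linarith
  have hy8 : L ^ 8 ≤ y := by
    have hsplit : L ^ 100000 = L ^ 8 * L ^ 99992 := by rw [← pow_add]
    have hbig : 2 ≤ L ^ 99992 := hL2.trans (le_self_pow₀ hL1 (by norm_num))
    have : 2 * L ^ 8 ≤ L ^ 100000 := by rw [hsplit]; nlinarith [pow_nonneg hL0 8]
    linarith
  have hy2r : (2 : ℝ) ≤ y := le_trans (hL2.trans (le_self_pow₀ hL1 (by norm_num))) hy8
  have hy2 : 2 ≤ y := by exact_mod_cast hy2r
  have hy0 : (0 : ℝ) < y := by linarith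
  have hlogy : Real.log y ≤ 1 / 2 * L ^ (1 / 6 : ℝ) := by
    have hlogy' : Real.log y ≤ 100000 * Real.log L := by
      have h := Real.log_le_log hy0 hyK
      rwa [Real.log_pow] at h
    calc Real.log y ≤ 100000 * (c₁ * L ^ (1 / 6 : ℝ)) := hlogy'.trans (by nlinarith)
      _ = 1 / 2 * ((1 / 2 : ℝ) ^ (1 / 6 : ℝ) * L ^ (1 / 6 : ℝ)) := by rw [hc₁]; ring
      _ ≤ 1 / 2 * (1 * L ^ (1 / 6 : ℝ)) := by
          have hh : (1 / 2 : ℝ) ^ (1 / 6 : ℝ) ≤ 1 := Real.rpow_le_one (by norm_num) (by norm_num) (by norm_num)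
          have h0 : 0 ≤ L ^ (1 / 6 : ℝ) := Real.rpow_nonneg hL0 _
          nlinarith
      _ = 1 / 2 * L ^ (1 / 6 : ℝ) := by ring
  refine ⟨hx1, hL2, hy2, hyK', hyK, (pow_le_pow_right₀ hL1 (by norm_num)).trans hy8, hy8, hlogy, ?_, ?_, ?_⟩
  · have h16 : L ^ (1 / 6 : ℝ) ≤ L ^ (1 / 5 : ℝ) := Real.rpow_le_rpow_of_exponent_le hL1 (by norm_num)
    have h0 : 0 ≤ L ^ (1 / 6 : ℝ) := Real.rpow_nonneg hL0 _
    linarith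
  · calc ((y : ℕ) : ℝ) ^ 200 ≤ (L ^ 100000) ^ 200 := pow_le_pow_left₀ hy0.le hyK 200
      _ = L ^ (200 * 100000) := by rw [← pow_mul, mul_comm]
      _ ≤ x ^ (1 / 2 : ℝ) := h3
  · calc x ^ (1 / 2 : ℝ) ≤ x ^ (1 : ℝ) := Real.rpow_le_rpow_of_exponent_le hx1.le (by norm_num)
      _ = x := Real.rpow_one x

/-- **The polylog regime at all scales `z ∈ [√x, x]`.**  For every threshold `z₀` and all large real
`x`, with `y = ⌊(log x)^{100000}⌋`, every natural `z` with `√x ≤ z ≤ x` satisfies `z ≥ z₀`, `(log z)⁸ ≤ y`,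
`log y ≤ ½ (log z)^{1/6}`, `y^{200} ≤ z`, `α(z, y) ≥ 1 − 10⁻⁴` and `Ψ(z, y) ≥ z^{39999/40000}` — the side
conditions of `ternary_holder_restriction` at the scale `z`.
[cite: Harper2016, §2.1 (2.1) and §5 (proof of Prop. 5)] -/
theorem polylog_regime_at_scales (z₀ : ℝ) :
    ∀ᶠ x : ℝ in atTop, ∀ z : ℕ, x ^ (1 / 2 : ℝ) ≤ z → (z : ℝ) ≤ x →
      z₀ ≤ z ∧ Real.log z ^ 8 ≤ (⌊Real.log x ^ 100000⌋₊ : ℝ) ∧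
      Real.log (⌊Real.log x ^ 100000⌋₊ : ℝ) ≤ 1 / 2 * Real.log z ^ (1 / 6 : ℝ) ∧
      ((⌊Real.log x ^ 100000⌋₊ : ℕ) : ℝ) ^ 200 ≤ z ∧
      1 - 1 / 10000 ≤ saddlePoint z ⌊Real.log x ^ 100000⌋₊ ∧
      (z : ℝ) ^ ((39999 : ℝ) / 40000) ≤
        ((Nat.smoothNumbersUpTo ⌊(z : ℝ)⌋₊ (⌊Real.log x ^ 100000⌋₊ + 1)).card : ℝ) := by
  set c₁ : ℝ := 1 / (2 * 100000) * (1 / 2 : ℝ) ^ (1 / 6 : ℝ) with hc₁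
  have hc₁0 : 0 < c₁ := by positivity
  have E0 : ∀ᶠ x : ℝ in atTop, z₀ ≤ x ^ (1 / 2 : ℝ) :=
    (tendsto_rpow_atTop (by norm_num)).eventually_ge_atTop _
  have E4 := eventually_scales
    (le_saddlePoint_of_polylog (K := 100000) (ε := 1 / 100000) (by norm_num) (by norm_num))
  have E5 := eventually_scales
    (card_smoothNumbersUpTo_polylog_ge (κ := 80000) (ε := 1 / 80000) (by norm_num) (by norm_num))
  filter_upwards [E0, polylog_regime_basic, eventually_loglog_le hc₁0, E4, E5] with x h0 hb h2 h4 h5 z hz hzx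
  obtain ⟨hx1, hL2, hy2, hyK', hyK, -, -, -, -, h200, -⟩ := hb
  set L : ℝ := Real.log x with hL
  set y : ℕ := ⌊L ^ 100000⌋₊ with hy
  have hx0 : 0 < x := by linarith
  have hL1 : 1 ≤ L := by linarith
  have hL0 : 0 ≤ L := by linarith
  have hy2r : (2 : ℝ) ≤ y := by exact_mod_cast hy2
  have hy0 : (0 : ℝ) < y := by linarith
  -- facts at the scale `z`
  have hsqrt0 : 0 < x ^ (1 / 2 : ℝ) := Real.rpow_pos_of_pos hx0 _
  have hz0 : (0 : ℝ) < z := lt_of_lt_of_le hsqrt0 hz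
  have hlogz_le : Real.log z ≤ L := Real.log_le_log hz0 hzx
  have hlogz_ge : L / 2 ≤ Real.log z := by
    have h := Real.log_le_log hsqrt0 hz
    rw [Real.log_rpow hx0] at h
    linarith
  have hlogz0 : 0 ≤ Real.log z := by linarith
  refine ⟨h0.trans hz, ?_, ?_, h200.trans hz, ?_, ?_⟩
  · -- `(log z)^8 ≤ y`
    have h8 : Real.log z ^ 8 ≤ L ^ 8 := pow_le_pow_left₀ hlogz0 hlogz_le 8
    have hsplit : L ^ 100000 = L ^ 8 * L ^ 99992 := by rw [← pow_add]
    have hbig : 2 ≤ L ^ 99992 := hL2.trans (le_self_pow₀ hL1 (by norm_num))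
    have : 2 * L ^ 8 ≤ L ^ 100000 := by rw [hsplit]; nlinarith [pow_nonneg hL0 8]
    linarith
  · -- `log y ≤ ½ (log z)^{1/6}`
    have hlogy : Real.log y ≤ 100000 * Real.log L := by
      have h := Real.log_le_log hy0 hyK
      rwa [Real.log_pow] at h
    have hhalf : (1 / 2 * L) ^ (1 / 6 : ℝ) ≤ Real.log z ^ (1 / 6 : ℝ) :=
      Real.rpow_le_rpow (by linarith) (by linarith) (by norm_num)
    calc Real.log y ≤ 100000 * (c₁ * L ^ (1 / 6 : ℝ)) := hlogy.trans (by nlinarith)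
      _ = 1 / 2 * ((1 / 2 : ℝ) ^ (1 / 6 : ℝ) * L ^ (1 / 6 : ℝ)) := by rw [hc₁]; ring
      _ = 1 / 2 * (1 / 2 * L) ^ (1 / 6 : ℝ) := by rw [Real.mul_rpow (by norm_num) hL0]
      _ ≤ 1 / 2 * Real.log z ^ (1 / 6 : ℝ) := by linarith
  · -- `α(z, y) ≥ 1 − 10⁻⁴`
    have h := h4 z hz y ?_
    · linarith
    · rw [show (100000 : ℝ) = ((100000 : ℕ) : ℝ) by norm_num, Real.rpow_natCast]
      have : Real.log z ^ 100000 ≤ L ^ 100000 := pow_le_pow_left₀ hlogz0 hlogz_le _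
      linarith
  · -- `Ψ(z, y) ≥ z^{39999/40000}`
    have h := h5 z hz
    rw [show (1 : ℝ) - 1 / 80000 - 1 / 80000 = 39999 / 40000 by norm_num] at h
    refine h.trans ?_
    rw [Nat.floor_natCast]
    have hk : ⌊Real.log z ^ (80000 : ℝ)⌋₊ + 1 ≤ y + 1 := by
      refine Nat.add_le_add_right ?_ 1
      have hle : Real.log z ^ (80000 : ℝ) ≤ L ^ 100000 := by
        rw [show (80000 : ℝ) = ((80000 : ℕ) : ℝ) by norm_num, Real.rpow_natCast]
        exact (pow_le_pow_left₀ hlogz0 hlogz_le 80000).trans (pow_le_pow_right₀ hL1 (by norm_num))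
      exact Nat.floor_le_floor hle
    exact_mod_cast Finset.card_le_card (Endgame.smoothNumbersUpTo_mono_right z hk)

end Literature.NumberTheory.Sieve

end
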